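import Mathlib
import Literature.Analysis.FunctionSpaces.BochnerProofs
import HarnessLib

/-!
# Nonnegativity of the cosine transform of a positive-definite function (stub A1)

Crux `LimitingAbsorption.FloorUpgrade` (stmt-AnomalousDissipation-15010), line `SketchIdeator1`,
stub `stub_cosTransform_nonneg`: for a continuous, even, exponentially bounded function
`C : ℝ → ℝ` that is positive-definite in the finite-sum sense, the cosine transform
`ρ(ξ) = ∫₀^∞ C(τ) cos(ξτ) dτ` is nonnegative (the `L¹` half of Bochner's theorem).

Route: real positive-definite + even ⇒ the tree's complex
`Literature.Analysis.FunctionSpaces.IsPositiveDefinite (fun τ => (C τ : ℂ))`; normalise by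
`C 0`; the tree's `IsPositiveDefinite.re_fourier_gauss_mul_nonneg` gives
`re 𝓕(e^{-σ|·|²/2} C) ≥ 0`; `σ → 0` by dominated convergence; finally
`re 𝓕 C (w) = 2 ∫_{τ>0} C τ cos(2π w τ)` by evenness, and `w = ξ/(2π)`.
-/

set_option linter.dupNamespace false

noncomputable section

open MeasureTheory Set Filter Topology
open scoped BigOperators FourierTransform ComplexConjugate

namespace Summit.AnomalousDissipation.AnomalousDissipation.Theorems.FloorUpgradeLine

namespace CosTransformNonneg

open Literature.Analysis.FunctionSpaces

/-- A real, even function that is positive-definite in the real finite-sum sense is positive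
definite as a complex-valued function (tree notion `IsPositiveDefinite`): writing `c = a + ib`,
`∑ᵢⱼ conj cᵢ cⱼ C(xⱼ - xᵢ) = ∑ᵢⱼ (aᵢaⱼ + bᵢbⱼ) C(xᵢ - xⱼ) + i ∑ᵢⱼ (aᵢbⱼ - bᵢaⱼ) C(xᵢ - xⱼ)`, whose
real part is nonnegative and whose imaginary part vanishes by symmetry. [folklore] -/
theorem isPositiveDefinite_ofReal (C : ℝ → ℝ) (heven : ∀ τ, C (-τ) = C τ)
    (hpd : ∀ (n : ℕ) (τ c : Fin n → ℝ), 0 ≤ ∑ i, ∑ j, c i * c j * C (τ i - τ j)) :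
    IsPositiveDefinite (fun τ : ℝ => (C τ : ℂ)) := by
  intro n x c
  have hsym : ∀ a b : ℝ, C (a - b) = C (b - a) := fun a b => by rw [← heven, neg_sub]
  have hre : (∑ i, ∑ j, conj (c i) * c j * (C (x j - x i) : ℂ)).re =
      (∑ i, ∑ j, (c i).re * (c j).re * C (x i - x j)) +
        ∑ i, ∑ j, (c i).im * (c j).im * C (x i - x j) := by
    rw [Complex.re_sum, ← Finset.sum_add_distrib]
    refine Finset.sum_congr rfl fun i _ => ?_
    rw [Complex.re_sum, ← Finset.sum_add_distrib]
    refine Finset.sum_congr rfl fun j _ => ?_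
    rw [Complex.re_mul_ofReal, Complex.mul_re, Complex.conj_re, Complex.conj_im, hsym (x j) (x i)]
    ring
  have him : (∑ i, ∑ j, conj (c i) * c j * (C (x j - x i) : ℂ)).im =
      (∑ i, ∑ j, (c i).re * (c j).im * C (x i - x j)) -
        ∑ i, ∑ j, (c i).im * (c j).re * C (x i - x j) := by
    rw [Complex.im_sum, ← Finset.sum_sub_distrib]
    refine Finset.sum_congr rfl fun i _ => ?_
    rw [Complex.im_sum, ← Finset.sum_sub_distrib]
    refine Finset.sum_congr rfl fun j _ => ?_
    rw [Complex.im_mul_ofReal, Complex.mul_im, Complex.conj_re, Complex.conj_im, hsym (x j) (x i)]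
    ring
  refine ⟨?_, ?_⟩
  · rw [hre]
    exact add_nonneg (hpd n x fun i => (c i).re) (hpd n x fun i => (c i).im)
  · rw [him, sub_eq_zero, Finset.sum_comm]
    refine Finset.sum_congr rfl fun i _ => Finset.sum_congr rfl fun j _ => ?_
    rw [hsym (x j) (x i)]
    ring

/-- A real, even, positive-definite function is bounded by its value at `0`: `|C τ| ≤ C 0`
(tree fact `IsPositiveDefinite.norm_apply_le_holds` for the complexification). [folklore] -/
theorem abs_le_apply_zero (C : ℝ → ℝ) (heven : ∀ τ, C (-τ) = C τ)
    (hpd : ∀ (n : ℕ) (τ c : Fin n → ℝ), 0 ≤ ∑ i, ∑ j, c i * c j * C (τ i - τ j)) (τ : ℝ) :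
    |C τ| ≤ C 0 := by
  have h := IsPositiveDefinite.norm_apply_le_holds (isPositiveDefinite_ofReal C heven hpd) τ
  simpa only [Complex.norm_real, Real.norm_eq_abs, Complex.ofReal_re] using h

/-- `τ ↦ e^{-γ|τ|}` is integrable on `ℝ` for `γ > 0`. [folklore] -/
theorem integrable_exp_neg_mul_abs {γ : ℝ} (hγ : 0 < γ) :
    Integrable fun τ : ℝ => Real.exp (-(γ * |τ|)) := by
  have h1 : IntegrableOn (fun τ : ℝ => Real.exp (-(γ * |τ|))) (Ioi 0) := by
    refine IntegrableOn.congr_fun (exp_neg_integrableOn_Ioi 0 hγ) (fun τ hτ => ?_)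
      measurableSet_Ioi
    rw [abs_of_pos hτ, neg_mul]
  have h2 : IntegrableOn (fun τ : ℝ => Real.exp (-(γ * |τ|))) (Iic 0) := by
    refine IntegrableOn.congr_fun (integrableOn_exp_mul_Iic hγ 0) (fun τ hτ => ?_)
      measurableSet_Iic
    rw [abs_of_nonpos hτ]
    ring_nf
  have h3 := integrableOn_union.2 ⟨h2, h1⟩
  rwa [Iic_union_Ioi, integrableOn_univ] at h3

/-- An exponentially bounded continuous function is integrable on `ℝ`. [folklore] -/
theorem integrable_of_abs_le_exp (C : ℝ → ℝ) (A γ : ℝ) (hC : Continuous C) (hγ : 0 < γ)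
    (hA : ∀ τ, |C τ| ≤ A * Real.exp (-(γ * |τ|))) : Integrable C := by
  refine Integrable.mono' ((integrable_exp_neg_mul_abs hγ).const_mul A) hC.aestronglyMeasurable
    (ae_of_all _ fun τ => ?_)
  rw [Real.norm_eq_abs]
  exact hA τ

/-- Removing the Gaussian damping: for a continuous integrable `D : ℝ → ℂ`, the Fourier
transforms of `e^{-σₙ|v|²/2} D(v)`, `σₙ = 1/(n+1)`, converge to `𝓕 D` pointwise (dominated
convergence with dominator `‖D‖`). [folklore] -/
theorem tendsto_fourier_gaussMul (D : ℝ → ℂ) (hDc : Continuous D) (hDi : Integrable D) (w : ℝ) :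
    Tendsto (fun n : ℕ =>
      𝓕 (fun v : ℝ => (Real.exp (-((1 / ((n : ℝ) + 1)) / 2) * ‖v‖ ^ 2) : ℂ) * D v) w)
      atTop (𝓝 (𝓕 D w)) := by
  simp only [Real.fourier_real_eq_integral_exp_smul]
  refine tendsto_integral_of_dominated_convergence (fun v => ‖D v‖) (fun n => ?_) hDi.norm
    (fun n => ae_of_all _ fun v => ?_) (ae_of_all _ fun v => ?_)
  · exact (Continuous.aestronglyMeasurable (by fun_prop))
  · rw [smul_eq_mul, norm_mul, Complex.norm_exp_ofReal_mul_I, one_mul, norm_mul,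
      Complex.norm_real, Real.norm_eq_abs, abs_of_pos (Real.exp_pos _)]
    refine mul_le_of_le_one_left (norm_nonneg _) ?_
    rw [Real.exp_le_one_iff]
    have h1 : (0 : ℝ) ≤ 1 / ((n : ℝ) + 1) := by positivity
    nlinarith [sq_nonneg ‖v‖]
  · have hc : Continuous fun σ : ℝ =>
        Complex.exp (↑(-2 * Real.pi * v * w) * Complex.I) •
          ((Real.exp (-(σ / 2) * ‖v‖ ^ 2) : ℂ) * D v) := by
      fun_prop
    have h := (hc.tendsto 0).comp (tendsto_one_div_add_atTop_nhds_zero_nat (𝕜 := ℝ))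
    rw [Function.comp_def] at h
    simpa using h

/-- The real part of the Fourier transform of (the complexification of) a continuous,
integrable, real positive-definite function bounded by `1` is nonnegative: the tree's
`IsPositiveDefinite.re_fourier_gauss_mul_nonneg` and `σ → 0`. [folklore] -/
theorem re_fourier_nonneg (C : ℝ → ℝ) (hC : Continuous C) (hint : Integrable C)
    (hPD : IsPositiveDefinite (fun τ : ℝ => (C τ : ℂ))) (hb : ∀ τ, |C τ| ≤ 1) (w : ℝ) :
    0 ≤ (𝓕 (fun τ : ℝ => (C τ : ℂ)) w).re := by
  have hDc : Continuous fun τ : ℝ => (C τ : ℂ) := by fun_prop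
  have hDi : Integrable fun τ : ℝ => (C τ : ℂ) := hint.ofReal
  have hDb : ∀ x, ‖((C x : ℝ) : ℂ)‖ ≤ 1 := fun x => by
    rw [Complex.norm_real, Real.norm_eq_abs]
    exact hb x
  have ht := ((Complex.continuous_re.tendsto _).comp (tendsto_fourier_gaussMul _ hDc hDi w))
  refine ge_of_tendsto' ht fun n => ?_
  have hσ : (0 : ℝ) < 1 / ((n : ℝ) + 1) := by positivity
  exact (hPD.re_fourier_gauss_mul_nonneg hDc hDb hσ w).1

/-- For a continuous, integrable, even real function, the real part of the Fourier transform of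
its complexification is twice the half-line cosine transform:
`re 𝓕 C (w) = 2 ∫_{τ>0} C τ cos(2π w τ) dτ`. [folklore] -/
theorem re_fourier_ofReal_eq (C : ℝ → ℝ) (hC : Continuous C) (hint : Integrable C)
    (heven : ∀ τ, C (-τ) = C τ) (w : ℝ) :
    (𝓕 (fun τ : ℝ => (C τ : ℂ)) w).re =
      2 * ∫ τ in Ioi (0 : ℝ), C τ * Real.cos (2 * Real.pi * w * τ) := by
  rw [Real.fourier_real_eq_integral_exp_smul]
  have hi : Integrable (fun v : ℝ =>
      Complex.exp (↑(-2 * Real.pi * v * w) * Complex.I) • ((C v : ℝ) : ℂ)) := by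
    refine Integrable.mono' hint.norm (Continuous.aestronglyMeasurable (by fun_prop))
      (ae_of_all _ fun v => le_of_eq ?_)
    rw [smul_eq_mul, norm_mul, Complex.norm_exp_ofReal_mul_I, one_mul, Complex.norm_real]
  have hpt : ∀ v : ℝ,
      RCLike.re (Complex.exp (↑(-2 * Real.pi * v * w) * Complex.I) • ((C v : ℝ) : ℂ)) =
        (fun t => C t * Real.cos (2 * Real.pi * w * t)) |v| := by
    intro v
    simp only [RCLike.re_to_complex, smul_eq_mul, Complex.re_mul_ofReal,
      Complex.exp_ofReal_mul_I_re]
    rcases le_total 0 v with hv | hv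
    · rw [abs_of_nonneg hv, show -2 * Real.pi * v * w = -(2 * Real.pi * w * v) by ring,
        Real.cos_neg, mul_comm]
    · rw [abs_of_nonpos hv, heven, show -2 * Real.pi * v * w = 2 * Real.pi * w * (-v) by ring,
        mul_comm]
  rw [← RCLike.re_to_complex, ← integral_re hi]
  simp only [hpt]
  exact integral_comp_abs (f := fun t => C t * Real.cos (2 * Real.pi * w * t))

end CosTransformNonneg

open CosTransformNonneg in
/-- **A1.** Nonnegativity of the cosine transform of a continuous, even, exponentially bounded
function that is positive-definite in the finite-sum sense (the `L¹` half of Bochner's theorem):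
real PD + even ⇒ the tree's complex `Literature.Analysis.FunctionSpaces.IsPositiveDefinite`,
normalisation by `C 0` (`|C| ≤ C 0`; `C 0 = 0` forces `C ≡ 0`), the tree's
`IsPositiveDefinite.re_fourier_gauss_mul_nonneg` (`re 𝓕(e^{-σ|·|²/2} C) ≥ 0`), `σ → 0` by
dominated convergence, and `re 𝓕 C (w) = 2 ρ(2πw)` by evenness. [folklore] -/
theorem stub_cosTransform_nonneg (C : ℝ → ℝ) (A γ : ℝ) (hC : Continuous C) (hγ : 0 < γ)
    (heven : ∀ τ, C (-τ) = C τ)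
    (hA : ∀ τ, |C τ| ≤ A * Real.exp (-(γ * |τ|)))
    (hpd : ∀ (n : ℕ) (τ c : Fin n → ℝ), 0 ≤ ∑ i, ∑ j, c i * c j * C (τ i - τ j))
    (ξ : ℝ) : 0 ≤ ∫ τ in Ioi (0 : ℝ), C τ * Real.cos (ξ * τ) := by
  have hint : Integrable C := integrable_of_abs_le_exp C A γ hC hγ hA
  have hb0 : ∀ τ, |C τ| ≤ C 0 := abs_le_apply_zero C heven hpd
  rcases eq_or_lt_of_le ((abs_nonneg _).trans (hb0 0)) with h0 | h0
  · have hCz : ∀ τ, C τ = 0 := fun τ => abs_nonpos_iff.1 (h0 ▸ hb0 τ)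
    simp [hCz]
  · set C' : ℝ → ℝ := fun τ => C τ / C 0 with hC'
    have hC'c : Continuous C' := hC.div_const _
    have hC'i : Integrable C' := hint.div_const _
    have hC'e : ∀ τ, C' (-τ) = C' τ := fun τ => by simp only [hC', heven]
    have hC'pd : ∀ (n : ℕ) (τ c : Fin n → ℝ), 0 ≤ ∑ i, ∑ j, c i * c j * C' (τ i - τ j) := by
      intro n τ c
      have h : ∑ i, ∑ j, c i * c j * C' (τ i - τ j) =
          (∑ i, ∑ j, c i * c j * C (τ i - τ j)) / C 0 := by
        rw [Finset.sum_div]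
        refine Finset.sum_congr rfl fun i _ => ?_
        rw [Finset.sum_div]
        refine Finset.sum_congr rfl fun j _ => ?_
        rw [hC', mul_div_assoc]
      rw [h]
      exact div_nonneg (hpd n τ c) h0.le
    have hC'b : ∀ τ, |C' τ| ≤ 1 := fun τ => by
      rw [hC', abs_div, abs_of_pos h0, div_le_one h0]
      exact hb0 τ
    have key := re_fourier_nonneg C' hC'c hC'i (isPositiveDefinite_ofReal C' hC'e hC'pd) hC'b
      (ξ / (2 * Real.pi))
    rw [re_fourier_ofReal_eq C' hC'c hC'i hC'e] at key
    have h2 : 2 * Real.pi * (ξ / (2 * Real.pi)) = ξ := by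
      field_simp
    rw [h2] at key
    have h3 : ∫ τ in Ioi (0 : ℝ), C' τ * Real.cos (ξ * τ) =
        (∫ τ in Ioi (0 : ℝ), C τ * Real.cos (ξ * τ)) / C 0 := by
      rw [← integral_div]
      refine integral_congr_ae (ae_of_all _ fun τ => ?_)
      simp only [hC']
      ring
    rw [h3] at key
    have h4 : 0 ≤ (∫ τ in Ioi (0 : ℝ), C τ * Real.cos (ξ * τ)) / C 0 :=
      nonneg_of_mul_nonneg_right (by simpa [mul_comm] using key) two_pos
    have h5 := (le_div_iff₀ h0).1 h4
    simpa using h5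

end Summit.AnomalousDissipation.AnomalousDissipation.Theorems.FloorUpgradeLine

end
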